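import Literature.Computability.AlgebraicComplexity.BI17GenericBinaryFormStabilizerProofs
import HarnessLib

/-!
# Normal forms of non-scalar `3 × 3` complex matrices under conjugation (for ternary stabilizers)

Theorem-only linear algebra (cell `val-lit`, row BI2017-A; no definitions, no named facts): every
non-scalar invertible `γ ∈ GL₃(ℂ)` satisfies `γ P = P T` for an invertible `P` and a matrix `T`
of one of four shapes —

* (D3) `T = diag(λ₀, λ₁, λ₂)` with pairwise distinct `λ_i`;
* (D2) `T = diag(λ, λ, μ)` with `λ ≠ μ`;
* (U1) `T = (μ 0 a; 0 λ b; 0 0 λ)` with `b ≠ 0` (a Jordan block of size `2`, possibly `μ = λ`);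
* (U2) `T = (λ λ 0; 0 λ λ; 0 0 λ) = λ · u` with `u` the regular unipotent (a Jordan block of
  size `3`)

(`exists_conj_normalForm_fin_three`): the Jordan normal form of `3 × 3` matrices, arranged for the
tree's column convention of `linSubst` (`x_i ↦ ∑_j T_{ji} x_j`, so an upper triangular `T` makes
`x₀` an exact eigen-coordinate). Built from an eigenvector (Mathlib's
`Module.End.exists_eigenvalue`), the tree's `2 × 2` triangularisation
`exists_mul_eq_mul_upperTriangular`, and explicit polynomial conjugating matrices. This is the
case list of the dimension count "a generic ternary form has trivial stabilizer"
(Matsumura–Monsky; BI 2017 Thm. 2.3 / App. Prop. 7.5; for quartics Poonen 2005 Thm. 3), consumed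
by the cell's generic-ternary-quartic stabilizer theorem. Honest framing: textbook linear
algebra; nothing here bears on VP versus VNP.

## References

* [BurgisserIkenmeyer2017] P. Bürgisser, C. Ikenmeyer, *Fundamental invariants of orbit closures*,
  J. Algebra 477 (2017) 390–434, Appendix Prop. 7.5 (ternary forms).
-/

noncomputable section

open MvPolynomial
open scoped BigOperators

namespace Literature.Computability.AlgebraicComplexity

/-! ### §1 Block-triangularisation by an eigenvector -/

section Block

/-- **First column of `P⁻¹ γ P` when the first column of `P` is an eigenvector of `γ`.**
[cite: BurgisserIkenmeyer2017, §7 (Appendix) Prop. 7.5] -/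
theorem conj_apply_zero_of_eigenvector {γ P : Matrix (Fin 3) (Fin 3) ℂ} {v : Fin 3 → ℂ} {t : ℂ}
    (hP : P.det ≠ 0) (hv : γ.mulVec v = t • v) (hcol : ∀ j, P j 0 = v j) (i : Fin 3) :
    (P⁻¹ * γ * P) i 0 = if i = 0 then t else 0 := by
  have hPu : IsUnit P.det := isUnit_iff_ne_zero.mpr hP
  have h1 : (P⁻¹ * γ * P) i 0 = ((P⁻¹ * γ).mulVec v) i := by
    simp only [Matrix.mul_apply, Matrix.mulVec, dotProduct, hcol]
  have h2 : (P⁻¹ * γ).mulVec v = t • P⁻¹.mulVec v := by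
    rw [← Matrix.mulVec_mulVec, hv, Matrix.mulVec_smul]
  have h3 : P⁻¹.mulVec v = fun k => (P⁻¹ * P) k 0 := by
    funext k
    simp only [Matrix.mul_apply, Matrix.mulVec, dotProduct, hcol]
  rw [h1, h2, h3, Matrix.nonsing_inv_mul _ hPu]
  simp [Matrix.one_apply]

/-- **Block-triangularisation**: an invertible `P` and `M` with `γ P = P M` and `M₁₀ = M₂₀ = 0`
(the first basis vector of `P` is an eigenvector of `γ`).
[cite: BurgisserIkenmeyer2017, §7 (Appendix) Prop. 7.5] -/
theorem exists_conj_first_column (γ : Matrix (Fin 3) (Fin 3) ℂ) :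
    ∃ P M : Matrix (Fin 3) (Fin 3) ℂ, P.det ≠ 0 ∧ γ * P = P * M ∧ M 1 0 = 0 ∧ M 2 0 = 0 := by
  obtain ⟨t, ht⟩ := Module.End.exists_eigenvalue (Matrix.toLin' γ)
  obtain ⟨v, hv⟩ := ht.exists_hasEigenvector
  have hγv : γ.mulVec v = t • v := by
    have := Module.End.mem_eigenspace_iff.mp hv.1
    rwa [Matrix.toLin'_apply] at this
  have hv0 : v ≠ 0 := hv.2
  -- a basis containing `v` as first vector
  obtain ⟨P, hP, hcol⟩ : ∃ P : Matrix (Fin 3) (Fin 3) ℂ, P.det ≠ 0 ∧ ∀ j, P j 0 = v j := by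
    by_cases h0 : v 0 ≠ 0
    · refine ⟨!![v 0, 0, 0; v 1, 1, 0; v 2, 0, 1], ?_, fun j => by fin_cases j <;> rfl⟩
      rw [Matrix.det_fin_three]; simpa using h0
    by_cases h1 : v 1 ≠ 0
    · refine ⟨!![v 0, 1, 0; v 1, 0, 0; v 2, 0, 1], ?_, fun j => by fin_cases j <;> rfl⟩
      rw [Matrix.det_fin_three]; simpa using h1
    have h2 : v 2 ≠ 0 := by
      intro h2
      apply hv0
      funext j
      fin_cases j
      · exact not_not.mp h0
      · exact not_not.mp h1
      · exact h2
    refine ⟨!![v 0, 1, 0; v 1, 0, 1; v 2, 0, 0], ?_, fun j => by fin_cases j <;> rfl⟩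
    rw [Matrix.det_fin_three]; simpa using h2
  have hPu : IsUnit P.det := isUnit_iff_ne_zero.mpr hP
  refine ⟨P, P⁻¹ * γ * P, hP, ?_, ?_, ?_⟩
  · rw [← Matrix.mul_assoc, ← Matrix.mul_assoc, Matrix.mul_nonsing_inv _ hPu, Matrix.one_mul]
  · rw [conj_apply_zero_of_eigenvector hP hγv hcol]; simp
  · rw [conj_apply_zero_of_eigenvector hP hγv hcol]; simp

/-- **Triangularisation of `3 × 3` complex matrices, refined**: `γ P = P T` with `P` invertible and
`T = (t s₁ s₂; 0 l b; 0 0 m)` upper triangular, where the lower-right block is either diagonal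
(`b = 0`) or a Jordan block (`l = m`, `b ≠ 0`). [cite: BurgisserIkenmeyer2017, §7 (Appendix) Prop. 7.5] -/
theorem exists_conj_upperTriangular_fin_three (γ : Matrix (Fin 3) (Fin 3) ℂ) :
    ∃ (P : Matrix (Fin 3) (Fin 3) ℂ) (t s₁ s₂ l b m : ℂ), P.det ≠ 0 ∧
      γ * P = P * !![t, s₁, s₂; 0, l, b; 0, 0, m] ∧ (b ≠ 0 → l = m) := by
  obtain ⟨P, M, hP, hPM, h10, h20⟩ := exists_conj_first_column γ
  -- the lower-right `2 × 2` block
  set B : Matrix (Fin 2) (Fin 2) ℂ := !![M 1 1, M 1 2; M 2 1, M 2 2] with hB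
  by_cases hsc : ∃ c : ℂ, B = c • (1 : Matrix (Fin 2) (Fin 2) ℂ)
  · obtain ⟨c, hc⟩ := hsc
    have h11 : M 1 1 = c := by have := congrFun (congrFun hc 0) 0; simpa [hB] using this
    have h12 : M 1 2 = 0 := by have := congrFun (congrFun hc 0) 1; simpa [hB] using this
    have h21 : M 2 1 = 0 := by have := congrFun (congrFun hc 1) 0; simpa [hB] using this
    have h22 : M 2 2 = c := by have := congrFun (congrFun hc 1) 1; simpa [hB] using this
    refine ⟨P, M 0 0, M 0 1, M 0 2, c, 0, c, hP, ?_, fun h => absurd rfl h⟩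
    rw [hPM]
    congr 1
    ext i j
    fin_cases i <;> fin_cases j <;> simp [h10, h20, h11, h12, h21, h22]
  · push Not at hsc
    obtain ⟨P₂, l, m, b, hP₂, hBP, hb1, hb2⟩ := exists_mul_eq_mul_upperTriangular B hsc
    -- lift `P₂` to `3 × 3`
    set Q : Matrix (Fin 3) (Fin 3) ℂ := !![1, 0, 0; 0, P₂ 0 0, P₂ 0 1; 0, P₂ 1 0, P₂ 1 1] with hQ
    have hQdet : Q.det = P₂.det := by
      rw [Matrix.det_fin_three, Matrix.det_fin_two]; simp [hQ]
    have e00 := congrFun (congrFun hBP 0) 0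
    have e01 := congrFun (congrFun hBP 0) 1
    have e10 := congrFun (congrFun hBP 1) 0
    have e11 := congrFun (congrFun hBP 1) 1
    simp only [hB, Matrix.mul_apply, Fin.sum_univ_two, Matrix.of_apply, Matrix.cons_val',
      Matrix.cons_val_zero, Matrix.cons_val_one, Matrix.empty_val', Matrix.cons_val_fin_one] at e00 e01 e10 e11
    refine ⟨P * Q, M 0 0, M 0 1 * P₂ 0 0 + M 0 2 * P₂ 1 0, M 0 1 * P₂ 0 1 + M 0 2 * P₂ 1 1,
      l, b, m, ?_, ?_, fun hb => ?_⟩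
    · rw [Matrix.det_mul, hQdet]; exact mul_ne_zero hP hP₂
    · rw [← Matrix.mul_assoc, hPM, Matrix.mul_assoc, Matrix.mul_assoc]
      congr 1
      ext i j
      fin_cases i <;> fin_cases j <;>
        simp [hQ, Matrix.mul_apply, Fin.sum_univ_three, h10, h20] <;>
        first
          | linear_combination e00
          | linear_combination e01
          | linear_combination e10
          | linear_combination e11
    · by_contra hlm
      exact hb (hb2 hlm)

end Block

/-! ### §2 The four normal forms -/

section NormalForm

/-- Chaining two conjugations. [cite: BurgisserIkenmeyer2017, §7 (Appendix) Prop. 7.5] -/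
theorem conj_trans {γ P T Q T' : Matrix (Fin 3) (Fin 3) ℂ} (hP : P.det ≠ 0) (hQ : Q.det ≠ 0)
    (h1 : γ * P = P * T) (h2 : T * Q = Q * T') :
    (P * Q).det ≠ 0 ∧ γ * (P * Q) = P * Q * T' := by
  refine ⟨by rw [Matrix.det_mul]; exact mul_ne_zero hP hQ, ?_⟩
  rw [← Matrix.mul_assoc, h1, Matrix.mul_assoc, h2, Matrix.mul_assoc]

/-- A conjugate of a non-scalar matrix is non-scalar. [cite: BurgisserIkenmeyer2017, §7 (Appendix) Prop. 7.5] -/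
theorem ne_smul_one_of_conj {γ P T : Matrix (Fin 3) (Fin 3) ℂ} (hP : P.det ≠ 0)
    (h1 : γ * P = P * T) (hns : ∀ c : ℂ, γ ≠ c • (1 : Matrix (Fin 3) (Fin 3) ℂ)) (c : ℂ) :
    T ≠ c • (1 : Matrix (Fin 3) (Fin 3) ℂ) := by
  intro hT
  apply hns c
  have hPu : IsUnit P.det := isUnit_iff_ne_zero.mpr hP
  calc γ = γ * P * P⁻¹ := by rw [Matrix.mul_assoc, Matrix.mul_nonsing_inv _ hPu, Matrix.mul_one]
    _ = c • (1 : Matrix (Fin 3) (Fin 3) ℂ) := by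
      rw [h1, hT, Matrix.mul_smul, Matrix.mul_one, Matrix.smul_mul, Matrix.mul_nonsing_inv _ hPu]

/-- **Normal forms of non-scalar invertible `3 × 3` complex matrices** (Jordan normal form,
arranged for the column convention of `linSubst`): `γ P = P T` with `P` invertible and `T`
diagonal with pairwise distinct entries (D3), or `diag(λ, λ, μ)` with `λ ≠ μ` (D2), or
`(μ 0 a; 0 λ b; 0 0 λ)` with `b ≠ 0` (U1), or `λ · u` with `u = (1 1 0; 0 1 1; 0 0 1)` (U2).
The case list of the dimension count behind BI 2017 Thm. 2.3 / App. Prop. 7.5 for ternary forms.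
[cite: BurgisserIkenmeyer2017, §7 (Appendix) Prop. 7.5] -/
theorem exists_conj_normalForm_fin_three (γ : Matrix (Fin 3) (Fin 3) ℂ) (hγ : γ.det ≠ 0)
    (hns : ∀ c : ℂ, γ ≠ c • (1 : Matrix (Fin 3) (Fin 3) ℂ)) :
    ∃ P : Matrix (Fin 3) (Fin 3) ℂ, P.det ≠ 0 ∧
      ((∃ l₀ l₁ l₂ : ℂ, l₀ ≠ l₁ ∧ l₀ ≠ l₂ ∧ l₁ ≠ l₂ ∧
          γ * P = P * !![l₀, 0, 0; 0, l₁, 0; 0, 0, l₂]) ∨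
       (∃ l μ : ℂ, l ≠ μ ∧ γ * P = P * !![l, 0, 0; 0, l, 0; 0, 0, μ]) ∨
       (∃ μ l a b : ℂ, b ≠ 0 ∧ γ * P = P * !![μ, 0, a; 0, l, b; 0, 0, l]) ∨
       (∃ l : ℂ, γ * P = P * !![l, l, 0; 0, l, l; 0, 0, l])) := by
  obtain ⟨P, t, s₁, s₂, l, b, m, hP, hPT, hblm⟩ := exists_conj_upperTriangular_fin_three γ
  have hTns := ne_smul_one_of_conj hP hPT hns
  -- the eigenvalues are nonzero
  have htlm : t * l * m ≠ 0 := by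
    have h := congrArg Matrix.det hPT
    rw [Matrix.det_mul, Matrix.det_mul] at h
    have hdetT : (!![t, s₁, s₂; 0, l, b; 0, 0, m] : Matrix (Fin 3) (Fin 3) ℂ).det = t * l * m := by
      rw [Matrix.det_fin_three]; simp
    rw [hdetT] at h
    intro h0
    rw [h0, mul_zero] at h
    exact mul_ne_zero hγ hP h
  have hl : l ≠ 0 := fun h => htlm (by rw [h]; ring)
  by_cases hb : b = 0
  · -- lower-right block diagonal: `T = (t s₁ s₂; 0 l 0; 0 0 m)`
    subst hb
    by_cases htl : t = l
    · subst htl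
      by_cases htm : t = m
      · subst htm
        -- B4: single eigenvalue, `(s₁, s₂) ≠ 0`
        by_cases hs₂ : s₂ = 0
        · subst hs₂
          have hs₁ : s₁ ≠ 0 := by
            intro hs₁
            apply hTns t
            subst hs₁
            ext i j; fin_cases i <;> fin_cases j <;> simp
          obtain ⟨hd, he⟩ := conj_trans hP (Q := !![0, 1, 0; 0, 0, 1; 1, 0, 0])
            (T' := !![t, 0, 0; 0, t, s₁; 0, 0, t]) (by simp [Matrix.det_fin_three]) hPT
            (by ext i j; fin_cases i <;> fin_cases j <;> simp [Matrix.mul_apply, Fin.sum_univ_three])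
          exact ⟨_, hd, Or.inr (Or.inr (Or.inl ⟨t, t, 0, s₁, hs₁, he⟩))⟩
        · obtain ⟨hd, he⟩ := conj_trans hP (Q := !![0, 1, 0; s₂, 0, 0; -s₁, 0, 1])
            (T' := !![t, 0, 0; 0, t, s₂; 0, 0, t]) (by simp [Matrix.det_fin_three, hs₂]) hPT
            (by ext i j; fin_cases i <;> fin_cases j <;>
                  simp [Matrix.mul_apply, Fin.sum_univ_three] <;> ring)
          exact ⟨_, hd, Or.inr (Or.inr (Or.inl ⟨t, t, 0, s₂, hs₂, he⟩))⟩
      · -- B2: `t = l ≠ m`; first kill `s₂`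
        have hmt : m - t ≠ 0 := sub_ne_zero.mpr (Ne.symm htm)
        obtain ⟨hd₁, he₁⟩ := conj_trans hP (Q := !![m - t, 0, s₂; 0, m - t, 0; 0, 0, m - t])
          (T' := !![t, s₁, 0; 0, t, 0; 0, 0, m])
          (by simp [Matrix.det_fin_three, hmt]) hPT
          (by ext i j; fin_cases i <;> fin_cases j <;>
                simp [Matrix.mul_apply, Fin.sum_univ_three] <;> ring)
        by_cases hs₁ : s₁ = 0
        · subst hs₁
          exact ⟨_, hd₁, Or.inr (Or.inl ⟨t, m, htm, he₁⟩)⟩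
        · obtain ⟨hd₂, he₂⟩ := conj_trans hd₁ (Q := !![0, 1, 0; 0, 0, 1; 1, 0, 0])
            (T' := !![m, 0, 0; 0, t, s₁; 0, 0, t]) (by simp [Matrix.det_fin_three]) he₁
            (by ext i j; fin_cases i <;> fin_cases j <;> simp [Matrix.mul_apply, Fin.sum_univ_three])
          exact ⟨_, hd₂, Or.inr (Or.inr (Or.inl ⟨m, t, 0, s₁, hs₁, he₂⟩))⟩
    · by_cases htm : t = m
      · -- B3: `t = m ≠ l`; first kill `s₁`
        subst htm
        have hlt : l - t ≠ 0 := sub_ne_zero.mpr (Ne.symm htl)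
        obtain ⟨hd₁, he₁⟩ := conj_trans hP (Q := !![l - t, s₁, 0; 0, l - t, 0; 0, 0, l - t])
          (T' := !![t, 0, s₂; 0, l, 0; 0, 0, t])
          (by simp [Matrix.det_fin_three, hlt]) hPT
          (by ext i j; fin_cases i <;> fin_cases j <;>
                simp [Matrix.mul_apply, Fin.sum_univ_three] <;> ring)
        by_cases hs₂ : s₂ = 0
        · subst hs₂
          obtain ⟨hd₂, he₂⟩ := conj_trans hd₁ (Q := !![1, 0, 0; 0, 0, 1; 0, 1, 0])
            (T' := !![t, 0, 0; 0, t, 0; 0, 0, l]) (by simp [Matrix.det_fin_three]) he₁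
            (by ext i j; fin_cases i <;> fin_cases j <;> simp [Matrix.mul_apply, Fin.sum_univ_three])
          exact ⟨_, hd₂, Or.inr (Or.inl ⟨t, l, htl, he₂⟩)⟩
        · obtain ⟨hd₂, he₂⟩ := conj_trans hd₁ (Q := !![0, 1, 0; 1, 0, 0; 0, 0, 1])
            (T' := !![l, 0, 0; 0, t, s₂; 0, 0, t]) (by simp [Matrix.det_fin_three]) he₁
            (by ext i j; fin_cases i <;> fin_cases j <;> simp [Matrix.mul_apply, Fin.sum_univ_three])
          exact ⟨_, hd₂, Or.inr (Or.inr (Or.inl ⟨l, t, 0, s₂, hs₂, he₂⟩))⟩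
      · -- B1: `t ∉ {l, m}`: diagonalise
        have hlt : l - t ≠ 0 := sub_ne_zero.mpr (Ne.symm htl)
        have hmt : m - t ≠ 0 := sub_ne_zero.mpr (Ne.symm htm)
        obtain ⟨hd₁, he₁⟩ := conj_trans hP
          (Q := !![(l - t) * (m - t), s₁ * (m - t), s₂ * (l - t); 0, (l - t) * (m - t), 0;
            0, 0, (l - t) * (m - t)])
          (T' := !![t, 0, 0; 0, l, 0; 0, 0, m])
          (by simp [Matrix.det_fin_three, hlt, hmt]) hPT
          (by ext i j; fin_cases i <;> fin_cases j <;>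
                simp [Matrix.mul_apply, Fin.sum_univ_three] <;> ring)
        by_cases hlm : l = m
        · subst hlm
          obtain ⟨hd₂, he₂⟩ := conj_trans hd₁ (Q := !![0, 0, 1; 1, 0, 0; 0, 1, 0])
            (T' := !![l, 0, 0; 0, l, 0; 0, 0, t]) (by simp [Matrix.det_fin_three]) he₁
            (by ext i j; fin_cases i <;> fin_cases j <;> simp [Matrix.mul_apply, Fin.sum_univ_three])
          exact ⟨_, hd₂, Or.inr (Or.inl ⟨l, t, Ne.symm htl, he₂⟩)⟩
        · exact ⟨_, hd₁, Or.inl ⟨t, l, m, htl, htm, hlm, he₁⟩⟩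
  · -- lower-right block a Jordan block: `l = m`, `b ≠ 0`
    have hlm : l = m := hblm hb
    subst hlm
    by_cases htl : t = l
    · subst htl
      by_cases hs₁ : s₁ = 0
      · subst hs₁
        exact ⟨P, hP, Or.inr (Or.inr (Or.inl ⟨t, t, s₂, b, hb, hPT⟩))⟩
      · -- regular: conjugate to `t · u`
        have ht : t ≠ 0 := hl
        obtain ⟨hd, he⟩ := conj_trans hP (Q := !![s₁ * b, s₂ * t, 0; 0, b * t, 0; 0, 0, t ^ 2])
          (T' := !![t, t, 0; 0, t, t; 0, 0, t])
          (by simp [Matrix.det_fin_three, hs₁, hb, ht]) hPT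
          (by ext i j; fin_cases i <;> fin_cases j <;>
                simp [Matrix.mul_apply, Fin.sum_univ_three] <;> ring)
        exact ⟨_, hd, Or.inr (Or.inr (Or.inr ⟨t, he⟩))⟩
    · -- A1: `t ≠ l`: kill `s₁`
      have hlt : l - t ≠ 0 := sub_ne_zero.mpr (Ne.symm htl)
      set x : ℂ := s₁ / (l - t) with hx
      have hx' : x * (l - t) = s₁ := div_mul_cancel₀ _ hlt
      obtain ⟨hd, he⟩ := conj_trans hP (Q := !![1, x, 0; 0, 1, 0; 0, 0, 1])
        (T' := !![t, 0, s₂ - x * b; 0, l, b; 0, 0, l]) (by simp [Matrix.det_fin_three]) hPT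
        (by
          ext i j
          fin_cases i <;> fin_cases j <;> simp [Matrix.mul_apply, Fin.sum_univ_three]
          linear_combination (-1 : ℂ) * hx')
      exact ⟨_, hd, Or.inr (Or.inr (Or.inl ⟨t, l, s₂ - x * b, b, hb, he⟩))⟩

end NormalForm

end Literature.Computability.AlgebraicComplexity
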